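import Mathlib
import Summits.Ventures.PercRepro.TriangleCapRowA2LastArith

/-!
# PercRepro — THE ROW `r = a + 2`: THE ARITHMETIC OF THE FINER MIXED READS AT `d ∈ {a − 2, a − 1}` FOR EVERY ROW `a ≥ 5`
(the primed versions of part 201a, generated by the `q`-shift `a = q + 6 → q + 5`; p3, gen 48; part 201e)

On the cell `(k, a, a + 2)` a vertex `z` of degree `d ∈ {a − 2, a − 1}` whose deletion leaves an `a`-bipartite
`D − z ⊆ K(A′, A′ᶜ)` with a neighbour on each side: `t` in-side neighbours (in `A′`) and `s₀ = d − t` off-side ones.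
The `K₄⁻`-freeness says an off-side neighbour is adjacent to at most one in-side neighbour of `z` (degree
`≤ a + 1 − t` in `D − z`) and an in-side neighbour to at most one off-side neighbour (degree `≤ k − a − s₀`); the
crude read `T + (k − a − 2) ≤ d (k − a − 2) + a` of the rows `r ≤ a + 1` is short by `2a − 6` here. Against the
triple-broom target `(a + 2)(k − 1 − (a + 2)) + (2k + 2a − 14)` (`a = q + 5`, `k = 3a + 2 + c`):
* `s₀ ≥ 2`, the closed form of `D − z` and `T ≤ t (k − a − s₀) + s₀ (a + 1 − t)`: slack
  `6qs + 4q + 14s − 4s² + 2cs + 2c + 10 ≥ 10` at `d = a − 2` and `6qs + 2q + 18s − 4s² + 2cs + 2c + 4 ≥ 4` at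
  `d = a − 1` (`s₀ = s + 2`);
* `s₀ = 1` and the missing graph of `D − z` not a star (`2 (s − 2)` below its closed form, `s = d + 2`), the single
  off-side neighbour at `≤ a + 2 − d`: slack `2a − 6` at `d = a − 2`, EXACTLY `0` at `d = a − 1`;
* `s₀ = 1`, the missing graph a star — then its centre is the off-side neighbour, isolated in `D − z`, which forces
  `d = a − 2`: closed form and `T ≤ (a − 3)(k − a − 2)`, slack `6`.
Axioms: standard.
-/

namespace PercRepro

namespace TriangleCap

namespace C047

/-- `d = a − 2`, `s₀ ≥ 2` off-side neighbours: `S′ ≤ closed (k − 1, a, a)`, `T ≤ t (k − a − s₀) + s₀ (a + 1 − t)`. -/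
theorem rowA2_two_mixed_ref' (a t s₀ k m' S' T : ℕ) (ha : 5 ≤ a) (hk : 3 * a + 2 ≤ k) (hts : t + s₀ + 2 = a)
    (hs₀ : 2 ≤ s₀) (ht1 : 1 ≤ t) (hmd : m' + (a - 2) + (a + 2) = a * (k - a))
    (hS' : S' + a * (k - 1 - 1 - a) ≤ m' * (k - 1)) (hT : T ≤ t * (k - a - s₀) + s₀ * (a + 1 - t)) :
    S' + 2 * T + (a - 2) + (a - 2) * (a - 2) + (a + 2) * (k - 1 - (a + 2)) + (2 * k + 2 * a - 14) ≤
      (m' + (a - 2)) * k := by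
  obtain ⟨q, rfl⟩ : ∃ q, a = q + 5 := ⟨a - 5, by omega⟩
  obtain ⟨s, rfl⟩ : ∃ s, s₀ = s + 2 := ⟨s₀ - 2, by omega⟩
  obtain ⟨c, rfl⟩ : ∃ c, k = 3 * (q + 5) + 2 + c := ⟨k - (3 * (q + 5) + 2), by omega⟩
  have hs : s ≤ q := by omega
  have e0 : q + 5 - 2 = q + 3 := by omega
  have e1 : 3 * (q + 5) + 2 + c - 1 - 1 - (q + 5) = 2 * q + 10 + c := by omega
  have e4 : 3 * (q + 5) + 2 + c - 1 = 3 * q + 16 + c := by omega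
  have e5 : 3 * (q + 5) + 2 + c - (q + 5) - (s + 2) = 2 * q + 10 + c - s := by omega
  have e6 : 3 * (q + 5) + 2 + c - 1 - (q + 5 + 2) = 2 * q + 9 + c := by omega
  have e7 : 2 * (3 * (q + 5) + 2 + c) + 2 * (q + 5) - 14 = 8 * q + 30 + 2 * c := by omega
  have e8 : 3 * (q + 5) + 2 + c - (q + 5) = 2 * q + 12 + c := by omega
  have e9 : q + 5 + 1 - t = s + 5 := by omega
  rw [e0] at hmd ⊢
  rw [e1, e4] at hS'
  rw [e5, e9] at hT
  rw [e6, e7]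
  rw [e8] at hmd
  have ht' : t + s = q + 1 := by omega
  have hss : s * s ≤ s * q := Nat.mul_le_mul_left s hs
  have hcs : 2 * q + 10 + c - s = 2 * q + 10 + c - s := rfl
  obtain ⟨u, hu⟩ : ∃ u, u = 2 * q + 10 + c - s := ⟨_, rfl⟩
  have hu' : u + s = 2 * q + 10 + c := by omega
  rw [← hu] at hT
  nlinarith [hS', hT, hmd, hss, ht', hu']

/-- `d = a − 1`, `s₀ ≥ 2` off-side neighbours: `S′ ≤ closed (k − 1, a, a + 1)`, `T ≤ t (k − a − s₀) + s₀ (a + 1 − t)`. -/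
theorem rowA2_one_mixed_ref' (a t s₀ k m' S' T : ℕ) (ha : 5 ≤ a) (hk : 3 * a + 2 ≤ k) (hts : t + s₀ + 1 = a)
    (hs₀ : 2 ≤ s₀) (ht1 : 1 ≤ t) (hmd : m' + (a - 1) + (a + 2) = a * (k - a))
    (hS' : S' + (a + 1) * (k - 1 - 1 - (a + 1)) ≤ m' * (k - 1)) (hT : T ≤ t * (k - a - s₀) + s₀ * (a + 1 - t)) :
    S' + 2 * T + (a - 1) + (a - 1) * (a - 1) + (a + 2) * (k - 1 - (a + 2)) + (2 * k + 2 * a - 14) ≤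
      (m' + (a - 1)) * k := by
  obtain ⟨q, rfl⟩ : ∃ q, a = q + 5 := ⟨a - 5, by omega⟩
  obtain ⟨s, rfl⟩ : ∃ s, s₀ = s + 2 := ⟨s₀ - 2, by omega⟩
  obtain ⟨c, rfl⟩ : ∃ c, k = 3 * (q + 5) + 2 + c := ⟨k - (3 * (q + 5) + 2), by omega⟩
  have hs : s ≤ q + 1 := by omega
  have e0 : q + 5 - 1 = q + 4 := by omega
  have e1 : 3 * (q + 5) + 2 + c - 1 - 1 - (q + 5 + 1) = 2 * q + 9 + c := by omega
  have e4 : 3 * (q + 5) + 2 + c - 1 = 3 * q + 16 + c := by omega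
  have e5 : 3 * (q + 5) + 2 + c - (q + 5) - (s + 2) = 2 * q + 10 + c - s := by omega
  have e6 : 3 * (q + 5) + 2 + c - 1 - (q + 5 + 2) = 2 * q + 9 + c := by omega
  have e7 : 2 * (3 * (q + 5) + 2 + c) + 2 * (q + 5) - 14 = 8 * q + 30 + 2 * c := by omega
  have e8 : 3 * (q + 5) + 2 + c - (q + 5) = 2 * q + 12 + c := by omega
  have e9 : q + 5 + 1 - t = s + 4 := by omega
  rw [e0] at hmd ⊢
  rw [e1, e4] at hS'
  rw [e5, e9] at hT
  rw [e6, e7]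
  rw [e8] at hmd
  have ht' : t + s = q + 2 := by omega
  have hss : s * s ≤ s * (q + 1) := Nat.mul_le_mul_left s hs
  obtain ⟨u, hu⟩ : ∃ u, u = 2 * q + 10 + c - s := ⟨_, rfl⟩
  have hu' : u + s = 2 * q + 10 + c := by omega
  rw [← hu] at hT
  nlinarith [hS', hT, hmd, hss, ht', hu']

/-- `d = a − 2`, a single off-side neighbour (at `≤ 4` in `D − z`), the missing graph of `D − z` not a star
(`2 (a − 2)` below its closed form): slack `2a − 6`. -/
theorem rowA2_two_nonstar' (a k m' S' T : ℕ) (ha : 5 ≤ a) (hk : 3 * a + 2 ≤ k)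
    (hmd : m' + (a - 2) + (a + 2) = a * (k - a))
    (hS' : S' + a * (k - 1 - 1 - a) + 2 * (a - 2) ≤ m' * (k - 1))
    (hT : T ≤ (a - 3) * (k - a - 2) + 4) :
    S' + 2 * T + (a - 2) + (a - 2) * (a - 2) + (a + 2) * (k - 1 - (a + 2)) + (2 * k + 2 * a - 14) ≤
      (m' + (a - 2)) * k := by
  obtain ⟨q, rfl⟩ : ∃ q, a = q + 5 := ⟨a - 5, by omega⟩
  obtain ⟨c, rfl⟩ : ∃ c, k = 3 * (q + 5) + 2 + c := ⟨k - (3 * (q + 5) + 2), by omega⟩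
  have e0 : q + 5 - 2 = q + 3 := by omega
  have e0' : q + 5 - 3 = q + 2 := by omega
  have e1 : 3 * (q + 5) + 2 + c - 1 - 1 - (q + 5) = 2 * q + 10 + c := by omega
  have e4 : 3 * (q + 5) + 2 + c - 1 = 3 * q + 16 + c := by omega
  have e5 : 3 * (q + 5) + 2 + c - (q + 5) - 2 = 2 * q + 10 + c := by omega
  have e6 : 3 * (q + 5) + 2 + c - 1 - (q + 5 + 2) = 2 * q + 9 + c := by omega
  have e7 : 2 * (3 * (q + 5) + 2 + c) + 2 * (q + 5) - 14 = 8 * q + 30 + 2 * c := by omega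
  have e8 : 3 * (q + 5) + 2 + c - (q + 5) = 2 * q + 12 + c := by omega
  rw [e0] at hmd hS' ⊢
  rw [e1, e4] at hS'
  rw [e0', e5] at hT
  rw [e6, e7]
  rw [e8] at hmd
  nlinarith [hS', hT, hmd]

/-- `d = a − 1`, a single off-side neighbour (at `≤ 3` in `D − z`), the missing graph of `D − z` not a star
(`2 (a − 1)` below its closed form): EXACT (slack `0`). -/
theorem rowA2_one_nonstar' (a k m' S' T : ℕ) (ha : 5 ≤ a) (hk : 3 * a + 2 ≤ k)
    (hmd : m' + (a - 1) + (a + 2) = a * (k - a))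
    (hS' : S' + (a + 1) * (k - 1 - 1 - (a + 1)) + 2 * (a - 1) ≤ m' * (k - 1))
    (hT : T ≤ (a - 2) * (k - a - 2) + 3) :
    S' + 2 * T + (a - 1) + (a - 1) * (a - 1) + (a + 2) * (k - 1 - (a + 2)) + (2 * k + 2 * a - 14) ≤
      (m' + (a - 1)) * k := by
  obtain ⟨q, rfl⟩ : ∃ q, a = q + 5 := ⟨a - 5, by omega⟩
  obtain ⟨c, rfl⟩ : ∃ c, k = 3 * (q + 5) + 2 + c := ⟨k - (3 * (q + 5) + 2), by omega⟩
  have e0 : q + 5 - 1 = q + 4 := by omega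
  have e0' : q + 5 - 2 = q + 3 := by omega
  have e1 : 3 * (q + 5) + 2 + c - 1 - 1 - (q + 5 + 1) = 2 * q + 9 + c := by omega
  have e4 : 3 * (q + 5) + 2 + c - 1 = 3 * q + 16 + c := by omega
  have e5 : 3 * (q + 5) + 2 + c - (q + 5) - 2 = 2 * q + 10 + c := by omega
  have e6 : 3 * (q + 5) + 2 + c - 1 - (q + 5 + 2) = 2 * q + 9 + c := by omega
  have e7 : 2 * (3 * (q + 5) + 2 + c) + 2 * (q + 5) - 14 = 8 * q + 30 + 2 * c := by omega
  have e8 : 3 * (q + 5) + 2 + c - (q + 5) = 2 * q + 12 + c := by omega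
  rw [e0] at hmd hS' ⊢
  rw [e1, e4] at hS'
  rw [e0', e5] at hT
  rw [e6, e7]
  rw [e8] at hmd
  nlinarith [hS', hT, hmd]

/-- `d = a − 2`, a single off-side neighbour which is the centre of the missing star of `D − z`, hence isolated there:
`S′ ≤ closed`, `T ≤ (a − 3)(k − a − 2)`: slack `6`. -/
theorem rowA2_two_star0' (a k m' S' T : ℕ) (ha : 5 ≤ a) (hk : 3 * a + 2 ≤ k)
    (hmd : m' + (a - 2) + (a + 2) = a * (k - a)) (hS' : S' + a * (k - 1 - 1 - a) ≤ m' * (k - 1))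
    (hT : T ≤ (a - 3) * (k - a - 2)) :
    S' + 2 * T + (a - 2) + (a - 2) * (a - 2) + (a + 2) * (k - 1 - (a + 2)) + (2 * k + 2 * a - 14) ≤
      (m' + (a - 2)) * k := by
  obtain ⟨q, rfl⟩ : ∃ q, a = q + 5 := ⟨a - 5, by omega⟩
  obtain ⟨c, rfl⟩ : ∃ c, k = 3 * (q + 5) + 2 + c := ⟨k - (3 * (q + 5) + 2), by omega⟩
  have e0 : q + 5 - 2 = q + 3 := by omega
  have e0' : q + 5 - 3 = q + 2 := by omega
  have e1 : 3 * (q + 5) + 2 + c - 1 - 1 - (q + 5) = 2 * q + 10 + c := by omega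
  have e4 : 3 * (q + 5) + 2 + c - 1 = 3 * q + 16 + c := by omega
  have e5 : 3 * (q + 5) + 2 + c - (q + 5) - 2 = 2 * q + 10 + c := by omega
  have e6 : 3 * (q + 5) + 2 + c - 1 - (q + 5 + 2) = 2 * q + 9 + c := by omega
  have e7 : 2 * (3 * (q + 5) + 2 + c) + 2 * (q + 5) - 14 = 8 * q + 30 + 2 * c := by omega
  have e8 : 3 * (q + 5) + 2 + c - (q + 5) = 2 * q + 12 + c := by omega
  rw [e0] at hmd ⊢
  rw [e1, e4] at hS'
  rw [e0', e5] at hT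
  rw [e6, e7]
  rw [e8] at hmd
  nlinarith [hS', hT, hmd]

end C047

end TriangleCap

end PercRepro
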